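import Summits.HodgeConjecture.HodgeConjecture.Theorems.F0P3cCMLocalNonsplitBorelTransportU2   -- ★∕GREEN part 1 (this seat): `comap_localNonsplitEquiv_torusU₂ ∕ _unipotentU₂`, `center_le_comap_glInt₂`, `placeForm_antidiagTwo_eq`
import Literature.NumberTheory.Automorphic.IwahoriStructureTransport                           -- ★ R5b-gen (B-p04): `StructureTransport.*`, `exists_iwahoriDatum_comap`
import Literature.NumberTheory.Automorphic.UnitaryGroupRayJacquetCriterionAnyRank              -- ★ `AnyRank.isCompact_comap_glInt` (any rank)
import HarnessLib

/-!
# `F0P3cCMBorelIwahoriDatumU2` — road (D) «DEEP-FL», block (U2-B) part 2 «CM TRANSPORT AT `N = 2`»: an Iwahori datum of the Borel of `H₂ = U(Φ₂)(L⁺_v)` at a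
# NON-SPLIT place, with dominance, exhaustion, normality in `K₀ = U(Φ₂)(𝒪_v)`, centre, (conditional) `N`-uniqueness and shell disjointness —
# the `N = 2` mirror of ★ `Theorems/F0P3CMBorelIwahoriDatum.exists_cmIwahoriDatum`, transported BY SHAPE from ANY datum of the one-place model

Cell `pub/hodgecm-mathlib`, crux H413 = `stmt-HodgeConjecture-24833` (lane `--supports … --as helper`), route HCCMUnconditional; seat LH4-p02 (g3) on the road (D)
owner LH6-p04 (g3)'s deal «IWAHORI-U2★» block (U2-B).  THEOREMS ONLY: no `def`, no instance, no notation, no `sorry`, no named fact.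
HONEST LABEL: HC_CM is proved only modulo the 7 printed citations (2 remaining: hLiu418 = stmt-HodgeConjecture-24832, h413 = stmt-HodgeConjecture-24833) until rung 0 closes;
count-neutral plumbing (the H-side Iwahori package consumed ABSTRACTLY by ★ F1-H p849597 ∕ ★ `F0P3cStCharTSCassHTrace` as `𝓘₂ : (cmBorelTriple L 2 v).IwahoriDatum` + `haN ∕ haNbar ∕ hexh`).

THE MATHEMATICS.  At a finite place `v` of `L⁺` that does not split in the CM field `L` (one place `w ∣ v`, `c • w = w`), the carrier is
`H₂ = U(Φ₂)(L⁺_v) = ↥(unitaryGroupOfForm (c ⊗ 1) (cmLocalForm L 2 v))` with the FIXED Borel triple `t = cmBorelTriple L 2 v = (B₂, T₂, N₂)`; the structure theory lives on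
the ONE-PLACE MODEL `U′ = U(σ_w, Φ₂)(L_w)` through the isomorphism of topological groups `e := localNonsplitEquiv` ([PlatonovRapinchuk1994, §5.1]; part 1: `T′.comap e = T₂`,
`N′.comap e = N₂`, `Z(U′)` integral).  THE TRANSPORT BY SHAPE: for ANY Iwahori datum `𝓘′` of the Borel of `U′` ([Casselman1995, Prop. 1.4.4]: levels `K′_n`, opposite radical
`N̄′`, ray `𝓘′.a = e a`) with integral levels and the dominance package at its ray (`haN′`, `haNbar′`, `hexh′`, normality under `U′ ∩ GL₂(𝒪_w)`), ★
`StructureTransport.exists_iwahoriDatum_comap` pulls it back to a datum `𝓘` for `t` with `𝓘.a = a`, `𝓘.K n = K′_n.comap e`, `𝓘.Nbar = N̄′.comap e`, and every clause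
transports (★ `StructureTransport.comap_*`); `K₀ := (U′ ∩ GL₂(𝒪_w)).comap e` is compact open, contains the centre and every level.  The `N`-component uniqueness
(`hinj`) and the shell disjointness modulo the centre (`hdisj`) are carried as IMPLICATIONS from their model forms, so that the package instantiates from the model datum
ALONE (block (U2-A), `iwahoriDatumU2` along `d(α, (σ_w α)⁻¹)` with ratio data ★ part 1 `exists_units_of_coe_eq_diagonal₂` — NOT imported here) and the two extra clauses are
discharged when their model lemmas land.

* **`exists_cmIwahoriDatum₂_of_model`** — THE PACKAGE BY SHAPE (T1₂): `∃ (𝓘 : (cmBorelTriple L 2 v).IwahoriDatum) (K₀ : Subgroup H₂), 𝓘.a = a ∧ IsCompact K₀ ∧ IsOpen K₀ ∧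
  Z(H₂) ≤ K₀ ∧ (∀ n, 𝓘.K n ≤ K₀) ∧ hKK₀ ∧ haN ∧ haNbar ∧ hexh ∧ (hinj′ → hinj) ∧ (hdisj′ → ∀ n, hdisj n) ∧ (K₀ ↔ GL₂(𝒪_w)) ∧ (∀ n, 𝓘.K n = K′_n.comap e) ∧ 𝓘.Nbar = N̄′.comap e`
  in the binder shapes of ★ `F0P3CMBorelIwahoriDatum.exists_cmIwahoriDatum` (clauses 1–9, 12) and of ★ F1-H ∕ ★ CassHTrace (`haN ∕ haNbar ∕ hexh`).

## References
* [Casselman1995] W. Casselman, *Introduction to the theory of admissible representations of `p`-adic reductive groups* (draft 1 May 1995), Prop. 1.4.3, Prop. 1.4.4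
  p. 14, §1.5 Lemma 1.5.1 p. 16.
* [Rogawski1990] J. D. Rogawski, *Automorphic Representations of Unitary Groups in Three Variables* (1990), §1.10 p. 9; §4.4 p. 46 (`H = U(2) × U(1)`); §12.2 p. 173.
* [PlatonovRapinchuk1994] V. Platonov, A. Rapinchuk, *Algebraic Groups and Number Theory* (1994), §2.3, §5.1 (the one-place model).
* [BruhatTits1972] F. Bruhat, J. Tits, *Groupes réductifs sur un corps local I*, (4.4.3)–(4.4.4).
-/

set_option autoImplicit false
-- the mandated namespace has the single-problem summit's repeated segment (`HodgeConjecture.HodgeConjecture`)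
set_option linter.dupNamespace false

open scoped MatrixGroups Pointwise WithZero
open ValuativeRel Matrix
open Literature.NumberTheory Literature.NumberTheory.Automorphic Literature.NumberTheory.Automorphic.UnitaryGroup
open _root_.NumberField _root_.IsDedekindDomain
open Summit.HodgeConjecture.HodgeConjecture.Cruxes.H413.F0P3cCMLocalNonsplitBorelTransportU2

namespace Summit.HodgeConjecture.HodgeConjecture.Cruxes.H413.F0P3cCMBorelIwahoriDatumU2

variable (L : Type) [Field L] [NumberField L] [IsCMField L] (v : HeightOneSpectrum (𝓞 ↥(maximalRealSubfield L)))
  (w : PlacesOver L v) (hw : IsCMField.complexConj L • w.1 = w.1)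

/-! ## §2 The package (T1₂) BY SHAPE: any model datum along `e a` with integral levels and the dominance package transports to `cmBorelTriple L 2 v` -/

set_option maxHeartbeats 1600000 in  -- the one-place model `«local» … ≃ₜ* U(σ_w,Φ₂)(L_w)` vs the CM carrier: long defeq unfoldings of `cmLocalForm` in every transported clause
/-- **THE CM IWAHORI DATUM PACKAGE FOR `U(Φ₂)(L⁺_v)`, BY SHAPE (T1₂).**  At a non-split `v` (`w ∣ v`, `c • w = w`), let `a ∈ U(Φ₂)(L⁺_v)` and let `𝓘′` be ANY Iwahori datum of the
Borel of the one-place model `U′ = U(σ_w, Φ₂)(L_w)` WITH RAY `𝓘′.a = e a` (e.g. block (U2-A)'s `iwahoriDatumU2` along `d(α, (σ_w α)⁻¹)`, ratio data `exists_units_of_coe_eq_diagonal₂`),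
whose levels are integral (`hK′`) and which satisfies the dominance package at its ray — `haN′` (`a′(K′_n ∩ N′)a′⁻¹ ⊆ K′_n`), `haNbar′` (`a′⁻¹(K′_n ∩ N̄′)a′ ⊆ K′_n ∩ N̄′`),
`hexh′` (`N′` exhausted), `hnorm′` (`K′_n` normalised by `U′ ∩ GL₂(𝒪_w)`).  Then there are an Iwahori datum `𝓘` for ★ `cmBorelTriple L 2 v` with `𝓘.a = a` and a compact open
`K₀ = U(Φ₂)(𝒪_v) := (U′ ∩ GL₂(𝒪_w)).comap e` containing the centre and every level, with `hKK₀`, `haN`, `haNbar`, `hexh` — the binder shapes of ★ F1-H (p849597) ∕ ★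
`F0P3cStCharTSCassHTrace` ∕ ★ `F0P3CMBorelIwahoriDatum.exists_cmIwahoriDatum` —, the `N`-component uniqueness `hinj` and the shell disjointness `hdisj` AS IMPLICATIONS from
their model forms, the description `k ∈ K₀ ↔ e k ∈ GL₂(𝒪_w)`, and the bookkeeping `𝓘.K n = K′_n.comap e`, `𝓘.Nbar = N̄′.comap e` (so that dominance at OTHER torus points transports
too).  Everything is ★ `StructureTransport.*` along ★ `localNonsplitEquiv` and §1. [cite: Casselman1995, Prop. 1.4.4 p. 14, §1.5 Lemma 1.5.1 p. 16]
[cite: PlatonovRapinchuk1994, §5.1] [cite: Rogawski1990, §1.10 p. 9; §4.4 p. 46] -/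
theorem exists_cmIwahoriDatum₂_of_model (a : ↥(unitaryGroupOfForm (conjLocal L (IsCMField.complexConj L) v) (cmLocalForm L 2 v)))
    (𝓘' : (borelTriple (galAdicCompletionMap (L := L) (IsCMField.complexConj L) hw)
      (placeForm (Matrix.of fun i j : Fin 2 => if i.val + j.val + 1 = 2 then (1 : L) else 0) w.1) (placeForm_antidiagTwo_eq L v w)).IwahoriDatum)
    (ha' : 𝓘'.a = localNonsplitEquiv (IsCMField.complexConj L) (Matrix.of fun i j : Fin 2 => if i.val + j.val + 1 = 2 then (1 : L) else 0)
      (IsCMField.complexConj_ne_one L) w hw a)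
    (hK' : ∀ n, 𝓘'.K n ≤ (glInt 2 (w.1.adicCompletion L)).comap
      (unitaryGroupOfForm (galAdicCompletionMap (L := L) (IsCMField.complexConj L) hw)
        (placeForm (Matrix.of fun i j : Fin 2 => if i.val + j.val + 1 = 2 then (1 : L) else 0) w.1)).subtype)
    (haN' : ∀ n, ∀ x ∈ 𝓘'.K n ⊓ (borelTriple (galAdicCompletionMap (L := L) (IsCMField.complexConj L) hw)
      (placeForm (Matrix.of fun i j : Fin 2 => if i.val + j.val + 1 = 2 then (1 : L) else 0) w.1) (placeForm_antidiagTwo_eq L v w)).N,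
      𝓘'.a * x * 𝓘'.a⁻¹ ∈ 𝓘'.K n)
    (haNbar' : ∀ n, ∀ x ∈ 𝓘'.K n ⊓ 𝓘'.Nbar, 𝓘'.a⁻¹ * x * 𝓘'.a ∈ 𝓘'.K n ⊓ 𝓘'.Nbar)
    (hexh' : ∀ n, ∀ x ∈ (borelTriple (galAdicCompletionMap (L := L) (IsCMField.complexConj L) hw)
      (placeForm (Matrix.of fun i j : Fin 2 => if i.val + j.val + 1 = 2 then (1 : L) else 0) w.1) (placeForm_antidiagTwo_eq L v w)).N,
      ∃ m : ℕ, ∀ m', m ≤ m' → 𝓘'.a ^ m' * x * (𝓘'.a ^ m')⁻¹ ∈ 𝓘'.K n)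
    (hnorm' : ∀ n, ∀ k ∈ (glInt 2 (w.1.adicCompletion L)).comap
      (unitaryGroupOfForm (galAdicCompletionMap (L := L) (IsCMField.complexConj L) hw)
        (placeForm (Matrix.of fun i j : Fin 2 => if i.val + j.val + 1 = 2 then (1 : L) else 0) w.1)).subtype, ∀ κ ∈ 𝓘'.K n, k⁻¹ * κ * k ∈ 𝓘'.K n) :
    ∃ (𝓘 : (cmBorelTriple L 2 v).IwahoriDatum) (K₀ : Subgroup ↥(unitaryGroupOfForm (conjLocal L (IsCMField.complexConj L) v) (cmLocalForm L 2 v))),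
      𝓘.a = a ∧ IsCompact (K₀ : Set ↥(unitaryGroupOfForm (conjLocal L (IsCMField.complexConj L) v) (cmLocalForm L 2 v))) ∧
      IsOpen (K₀ : Set ↥(unitaryGroupOfForm (conjLocal L (IsCMField.complexConj L) v) (cmLocalForm L 2 v))) ∧
      Subgroup.center ↥(unitaryGroupOfForm (conjLocal L (IsCMField.complexConj L) v) (cmLocalForm L 2 v)) ≤ K₀ ∧ (∀ n, 𝓘.K n ≤ K₀) ∧
      (∀ n, ∀ k ∈ K₀, ∀ κ ∈ 𝓘.K n, k⁻¹ * κ * k ∈ 𝓘.K n) ∧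
      (∀ n, ∀ x ∈ 𝓘.K n ⊓ (cmBorelTriple L 2 v).N, 𝓘.a * x * 𝓘.a⁻¹ ∈ 𝓘.K n) ∧
      (∀ n, ∀ x ∈ 𝓘.K n ⊓ 𝓘.Nbar, 𝓘.a⁻¹ * x * 𝓘.a ∈ 𝓘.K n ⊓ 𝓘.Nbar) ∧
      (∀ n, ∀ x ∈ (cmBorelTriple L 2 v).N, ∃ m : ℕ, ∀ m', m ≤ m' → 𝓘.a ^ m' * x * (𝓘.a ^ m')⁻¹ ∈ 𝓘.K n) ∧
      ((∀ nb ∈ 𝓘'.Nbar, ∀ m ∈ (borelTriple (galAdicCompletionMap (L := L) (IsCMField.complexConj L) hw)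
          (placeForm (Matrix.of fun i j : Fin 2 => if i.val + j.val + 1 = 2 then (1 : L) else 0) w.1) (placeForm_antidiagTwo_eq L v w)).M,
          ∀ n ∈ (borelTriple (galAdicCompletionMap (L := L) (IsCMField.complexConj L) hw)
            (placeForm (Matrix.of fun i j : Fin 2 => if i.val + j.val + 1 = 2 then (1 : L) else 0) w.1) (placeForm_antidiagTwo_eq L v w)).N,
          ∀ nb' ∈ 𝓘'.Nbar, ∀ m' ∈ (borelTriple (galAdicCompletionMap (L := L) (IsCMField.complexConj L) hw)
            (placeForm (Matrix.of fun i j : Fin 2 => if i.val + j.val + 1 = 2 then (1 : L) else 0) w.1) (placeForm_antidiagTwo_eq L v w)).M,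
          ∀ n' ∈ (borelTriple (galAdicCompletionMap (L := L) (IsCMField.complexConj L) hw)
            (placeForm (Matrix.of fun i j : Fin 2 => if i.val + j.val + 1 = 2 then (1 : L) else 0) w.1) (placeForm_antidiagTwo_eq L v w)).N,
          nb * m * n = nb' * m' * n' → n = n') →
        ∀ nb ∈ 𝓘.Nbar, ∀ m ∈ (cmBorelTriple L 2 v).M, ∀ n ∈ (cmBorelTriple L 2 v).N, ∀ nb' ∈ 𝓘.Nbar, ∀ m' ∈ (cmBorelTriple L 2 v).M,
          ∀ n' ∈ (cmBorelTriple L 2 v).N, nb * m * n = nb' * m' * n' → n = n') ∧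
      ((∀ n, Pairwise (Function.onFun Disjoint fun m : ℕ =>
          (QuotientGroup.mk : ↥(unitaryGroupOfForm (galAdicCompletionMap (L := L) (IsCMField.complexConj L) hw)
              (placeForm (Matrix.of fun i j : Fin 2 => if i.val + j.val + 1 = 2 then (1 : L) else 0) w.1)) →
            ↥(unitaryGroupOfForm (galAdicCompletionMap (L := L) (IsCMField.complexConj L) hw)
              (placeForm (Matrix.of fun i j : Fin 2 => if i.val + j.val + 1 = 2 then (1 : L) else 0) w.1)) ⧸
              Subgroup.center ↥(unitaryGroupOfForm (galAdicCompletionMap (L := L) (IsCMField.complexConj L) hw)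
                (placeForm (Matrix.of fun i j : Fin 2 => if i.val + j.val + 1 = 2 then (1 : L) else 0) w.1))) ''
            DoubleCoset.doubleCoset (𝓘'.a ^ m) (𝓘'.K n : Set ↥(unitaryGroupOfForm (galAdicCompletionMap (L := L) (IsCMField.complexConj L) hw)
              (placeForm (Matrix.of fun i j : Fin 2 => if i.val + j.val + 1 = 2 then (1 : L) else 0) w.1))) (𝓘'.K n))) →
        ∀ n, Pairwise (Function.onFun Disjoint fun m : ℕ =>
          (QuotientGroup.mk : ↥(unitaryGroupOfForm (conjLocal L (IsCMField.complexConj L) v) (cmLocalForm L 2 v)) →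
            ↥(unitaryGroupOfForm (conjLocal L (IsCMField.complexConj L) v) (cmLocalForm L 2 v)) ⧸
              Subgroup.center ↥(unitaryGroupOfForm (conjLocal L (IsCMField.complexConj L) v) (cmLocalForm L 2 v))) ''
            DoubleCoset.doubleCoset (𝓘.a ^ m) (𝓘.K n : Set ↥(unitaryGroupOfForm (conjLocal L (IsCMField.complexConj L) v) (cmLocalForm L 2 v))) (𝓘.K n))) ∧
      (∀ k : ↥(unitaryGroupOfForm (conjLocal L (IsCMField.complexConj L) v) (cmLocalForm L 2 v)), k ∈ K₀ ↔
        (((localNonsplitEquiv (IsCMField.complexConj L) (Matrix.of fun i j : Fin 2 => if i.val + j.val + 1 = 2 then (1 : L) else 0)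
            (IsCMField.complexConj_ne_one L) w hw) k :
          ↥(unitaryGroupOfForm (galAdicCompletionMap (L := L) (IsCMField.complexConj L) hw)
            (placeForm (Matrix.of fun i j : Fin 2 => if i.val + j.val + 1 = 2 then (1 : L) else 0) w.1))) :
            GL (Fin 2) (w.1.adicCompletion L)) ∈ glInt 2 (w.1.adicCompletion L)) ∧
      (∀ n, 𝓘.K n = (𝓘'.K n).comap
        (localNonsplitEquiv (IsCMField.complexConj L) (Matrix.of fun i j : Fin 2 => if i.val + j.val + 1 = 2 then (1 : L) else 0)
            (IsCMField.complexConj_ne_one L) w hw :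
          «local» L (IsCMField.complexConj L) 2 (Matrix.of fun i j : Fin 2 => if i.val + j.val + 1 = 2 then (1 : L) else 0) v →*
            ↥(unitaryGroupOfForm (galAdicCompletionMap (L := L) (IsCMField.complexConj L) hw)
              (placeForm (Matrix.of fun i j : Fin 2 => if i.val + j.val + 1 = 2 then (1 : L) else 0) w.1)))) ∧
      𝓘.Nbar = 𝓘'.Nbar.comap
        (localNonsplitEquiv (IsCMField.complexConj L) (Matrix.of fun i j : Fin 2 => if i.val + j.val + 1 = 2 then (1 : L) else 0)
            (IsCMField.complexConj_ne_one L) w hw :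
          «local» L (IsCMField.complexConj L) 2 (Matrix.of fun i j : Fin 2 => if i.val + j.val + 1 = 2 then (1 : L) else 0) v →*
            ↥(unitaryGroupOfForm (galAdicCompletionMap (L := L) (IsCMField.complexConj L) hw)
              (placeForm (Matrix.of fun i j : Fin 2 => if i.val + j.val + 1 = 2 then (1 : L) else 0) w.1))) := by
  have hσc : Continuous (galAdicCompletionMap (L := L) (IsCMField.complexConj L) hw) := continuous_galAdicCompletionMap (L := L) (IsCMField.complexConj L) hw
  -- abbreviate the model isomorphism
  set e := localNonsplitEquiv (IsCMField.complexConj L) (Matrix.of fun i j : Fin 2 => if i.val + j.val + 1 = 2 then (1 : L) else 0)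
    (IsCMField.complexConj_ne_one L) w hw with he
  -- transport of the datum
  obtain ⟨𝓘, hNbar, ha𝓘, hK⟩ := StructureTransport.exists_iwahoriDatum_comap e (cmBorelTriple L 2 v)
    (borelTriple (galAdicCompletionMap (L := L) (IsCMField.complexConj L) hw)
      (placeForm (Matrix.of fun i j : Fin 2 => if i.val + j.val + 1 = 2 then (1 : L) else 0) w.1) (placeForm_antidiagTwo_eq L v w))
    (comap_localNonsplitEquiv_torusU₂ L v w hw) (comap_localNonsplitEquiv_unipotentU₂ L v w hw) 𝓘'
  have hsymm : e.symm (e a) = a := e.symm_apply_apply _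
  have ha𝓘' : 𝓘.a = a := by rw [ha𝓘, ha', hsymm]
  have hsymm' : e.symm 𝓘'.a = a := by rw [ha', hsymm]
  have hNe : ((borelTriple (galAdicCompletionMap (L := L) (IsCMField.complexConj L) hw)
      (placeForm (Matrix.of fun i j : Fin 2 => if i.val + j.val + 1 = 2 then (1 : L) else 0) w.1) (placeForm_antidiagTwo_eq L v w)).N).comap
      (e : «local» L (IsCMField.complexConj L) 2 (Matrix.of fun i j : Fin 2 => if i.val + j.val + 1 = 2 then (1 : L) else 0) v →*
        ↥(unitaryGroupOfForm (galAdicCompletionMap (L := L) (IsCMField.complexConj L) hw)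
          (placeForm (Matrix.of fun i j : Fin 2 => if i.val + j.val + 1 = 2 then (1 : L) else 0) w.1))) = (cmBorelTriple L 2 v).N :=
    comap_localNonsplitEquiv_unipotentU₂ L v w hw
  have hMe : ((borelTriple (galAdicCompletionMap (L := L) (IsCMField.complexConj L) hw)
      (placeForm (Matrix.of fun i j : Fin 2 => if i.val + j.val + 1 = 2 then (1 : L) else 0) w.1) (placeForm_antidiagTwo_eq L v w)).M).comap
      (e : «local» L (IsCMField.complexConj L) 2 (Matrix.of fun i j : Fin 2 => if i.val + j.val + 1 = 2 then (1 : L) else 0) v →*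
        ↥(unitaryGroupOfForm (galAdicCompletionMap (L := L) (IsCMField.complexConj L) hw)
          (placeForm (Matrix.of fun i j : Fin 2 => if i.val + j.val + 1 = 2 then (1 : L) else 0) w.1))) = (cmBorelTriple L 2 v).M :=
    comap_localNonsplitEquiv_torusU₂ L v w hw
  refine ⟨𝓘, ((glInt 2 (w.1.adicCompletion L)).comap (unitaryGroupOfForm (galAdicCompletionMap (L := L) (IsCMField.complexConj L) hw)
      (placeForm (Matrix.of fun i j : Fin 2 => if i.val + j.val + 1 = 2 then (1 : L) else 0) w.1)).subtype).comap
      (e : «local» L (IsCMField.complexConj L) 2 (Matrix.of fun i j : Fin 2 => if i.val + j.val + 1 = 2 then (1 : L) else 0) v →*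
        ↥(unitaryGroupOfForm (galAdicCompletionMap (L := L) (IsCMField.complexConj L) hw)
          (placeForm (Matrix.of fun i j : Fin 2 => if i.val + j.val + 1 = 2 then (1 : L) else 0) w.1))),
    ha𝓘', ?_, ?_, ?_, ?_, ?_, ?_, ?_, ?_, ?_, ?_, fun k => Iff.rfl, hK, hNbar⟩
  · -- compact
    exact StructureTransport.isCompact_coe_comap e (AnyRank.isCompact_comap_glInt (galAdicCompletionMap (L := L) (IsCMField.complexConj L) hw) hσc)
  · -- open
    exact StructureTransport.isOpen_coe_comap e ((isOpen_glInt 2 (w.1.adicCompletion L)).preimage continuous_subtype_val)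
  · -- centre
    exact StructureTransport.center_le_comap e (center_le_comap_glInt₂ L v w hw)
  · -- levels inside `K₀`
    intro n x hx
    rw [hK n] at hx
    exact hK' n hx
  · -- normality
    intro n k hk κ hκ
    rw [hK n] at hκ ⊢
    exact StructureTransport.comap_normal e (hnorm' n) k hk κ hκ
  · -- `haN`
    intro n x hx
    rw [hK n, ← hNe] at hx
    have h1 := StructureTransport.comap_conj_mem e (haN' n) x hx
    rw [hsymm'] at h1
    rw [hK n, ha𝓘']
    exact h1
  · -- `haNbar`
    intro n x hx
    rw [hK n, hNbar] at hx
    have h1 := StructureTransport.comap_inv_conj_mem_inf e (haNbar' n) x hx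
    rw [hsymm'] at h1
    rw [hK n, hNbar, ha𝓘']
    exact h1
  · -- `hexh`
    intro n x hx
    rw [← hNe] at hx
    obtain ⟨m, hm⟩ := StructureTransport.comap_exhaustion e (hexh' n) x hx
    refine ⟨m, fun m' hm' => ?_⟩
    have h1 := hm m' hm'
    rw [hsymm'] at h1
    rw [hK n, ha𝓘']
    exact h1
  · -- `hinj` from its model form
    intro hinj' nb hnb m hm n hn nb' hnb' m' hm' n' hn' h
    rw [hNbar] at hnb hnb'
    rw [← hMe] at hm hm'
    rw [← hNe] at hn hn'
    exact StructureTransport.comap_hinj e hinj' nb hnb m hm n hn nb' hnb' m' hm' n' hn' h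
  · -- `hdisj` from its model form
    intro hdisj' n
    have h2 := StructureTransport.comap_pairwise_disjoint_image_mk e (hdisj' n)
    rw [hsymm', ← hK n, ← ha𝓘'] at h2
    exact h2

end Summit.HodgeConjecture.HodgeConjecture.Cruxes.H413.F0P3cCMBorelIwahoriDatumU2
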